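import Mathlib
import Summits.MatrixMultiplication.MatrixMultiplication.Theorems.SnSubsetDichotomyNoThresholdSubsetTriplePairDiffEqChargeSum
import Summits.MatrixMultiplication.MatrixMultiplication.Theorems.SnSubsetDichotomyNoThresholdSubsetTripleShapeBeforeDefs
import Summits.MatrixMultiplication.MatrixMultiplication.Theorems.SnSubsetDichotomyNoThresholdSubsetTriplePlancherelStepDefs

/-!
# The increment identity in `PlancherelStep` language: `J(T) = Σ_k π_k · incr (shapeBefore T k) (T k)`

Stub `pairDiff_eq_sum_incr` of line `klr-graded-polynomial-method` (crux
`SnSubsetDichotomy.NoThresholdSubsetTriple`, stmt-MatrixMultiplication-8302).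

For a standard Young tableau `T` of shape `μ ⊢ n` (growth sequence `T.1 k = (row, col)` of the entry `k`,
sign `π_k = (−1)^(row + col)`), the parity-signed SW-minus-NE pair statistic `J(T)` equals
`Σ_k π_k · x_{T.1 k}(shapeBefore T.1 k)`, where `x_y(ν) = PlancherelStep.incr ν y = R(row y) − C(col y)` is the
J-increment of the cell set `ν` seen from the node `y` and `shapeBefore T.1 k` is the shape of the entries `< k`.

Proof.  The tree theorem `stub_pairDiff_eq_chargeSum` already writes `J(T)` as
`Σ_k π_k · (ROWSUM k − COLSUM k)` with
`ROWSUM k = Σ_{i < n} [row k < i ∧ #{j < k in row i} odd] (−1)^i` (and the column analogue).  This file is the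
dictionary `ROWSUM k = chargeBelow (shapeBefore T.1 k) (row k)`, `COLSUM k = chargeRight (shapeBefore T.1 k) (col k)`:
(1) `rowLen (shapeBefore T.1 k) i = #{j < k : row j = i}` because `T.1` is injective (`Finset.filter_image`,
`Finset.card_image_of_injective`); (2) both sums may be taken over `Finset.range n`: `chargeBelow` sums the row
charges over `i ≤ |shapeBefore T.1 k| = k < n`, and a row of index `≥ k` of the lower set `shapeBefore T.1 k`
(`shapeBefore_api`) is empty — a cell in row `i` drags the column segment above it, `i + 1` cells, into the set —
so its charge vanishes (`Finset.sum_subset`, `Finset.sum_filter`); (3) columns alike.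
-/

open scoped BigOperators
open Literature.NumberTheory.DiophantineGeometry (StdFilling)

namespace Summit.MatrixMultiplication.MatrixMultiplication.Theorems

open PlancherelStep

set_option linter.dupNamespace false in
-- adapted from SnSubsetDichotomyNoThresholdSubsetTripleIncrInsertSucc.lean (private there)
/-- In a lower set a cell `(i, j)` drags the column segment `(0, j), …, (i, j)` and the row segment
`(i, 0), …, (i, j)` into the set, so `i < |ν|` and `j < |ν|`. [folklore] -/
private theorem lt_card_of_mem' {ν : Finset (ℕ × ℕ)} (hν : IsLowerSet (ν : Set (ℕ × ℕ))) {i j : ℕ}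
    (h : (i, j) ∈ ν) : i < ν.card ∧ j < ν.card := by
  constructor
  · have hsub : (Finset.range (i + 1)).image (fun k => (k, j)) ⊆ ν := by
      intro y hy
      simp only [Finset.mem_image, Finset.mem_range] at hy
      obtain ⟨k, hk, rfl⟩ := hy
      exact Finset.mem_coe.1 (hν (Prod.mk_le_mk.2 ⟨by omega, le_rfl⟩) (Finset.mem_coe.2 h))
    have hcard := Finset.card_le_card hsub
    rw [Finset.card_image_of_injective _ (Prod.mk_left_injective j), Finset.card_range] at hcard
    omega
  · have hsub : (Finset.range (j + 1)).image (Prod.mk i) ⊆ ν := by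
      intro y hy
      simp only [Finset.mem_image, Finset.mem_range] at hy
      obtain ⟨k, hk, rfl⟩ := hy
      exact Finset.mem_coe.1 (hν (Prod.mk_le_mk.2 ⟨le_rfl, by omega⟩) (Finset.mem_coe.2 h))
    have hcard := Finset.card_le_card hsub
    rw [Finset.card_image_of_injective _ (Prod.mk_right_injective i), Finset.card_range] at hcard
    omega

set_option linter.dupNamespace false in
-- adapted from SnSubsetDichotomyNoThresholdSubsetTripleIncrInsertSucc.lean (private there)
/-- Rows of index `≥ |ν|` of a lower set are empty, so they carry no charge. [folklore] -/
private theorem rowCharge_eq_zero_of_card_le' {ν : Finset (ℕ × ℕ)} (hν : IsLowerSet (ν : Set (ℕ × ℕ)))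
    {i : ℕ} (hi : ν.card ≤ i) : rowCharge ν i = 0 := by
  have h : rowLen ν i = 0 := by
    rw [rowLen, Finset.card_eq_zero, Finset.filter_eq_empty_iff]
    rintro ⟨a, b⟩ hx (rfl : a = i)
    exact absurd (lt_card_of_mem' hν hx).1 (not_lt.2 hi)
  rw [rowCharge, h, if_neg Nat.not_odd_zero]

set_option linter.dupNamespace false in
-- adapted from SnSubsetDichotomyNoThresholdSubsetTripleIncrInsertSucc.lean (private there)
/-- Columns of index `≥ |ν|` of a lower set are empty, so they carry no charge. [folklore] -/
private theorem colCharge_eq_zero_of_card_le' {ν : Finset (ℕ × ℕ)} (hν : IsLowerSet (ν : Set (ℕ × ℕ)))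
    {j : ℕ} (hj : ν.card ≤ j) : colCharge ν j = 0 := by
  have h : colLen ν j = 0 := by
    rw [colLen, Finset.card_eq_zero, Finset.filter_eq_empty_iff]
    rintro ⟨a, b⟩ hx (rfl : b = j)
    exact absurd (lt_card_of_mem' hν hx).2 (not_lt.2 hj)
  rw [colCharge, h, if_neg Nat.not_odd_zero]

set_option linter.dupNamespace false in
/-- The row tail `R(r)` of a lower set `ν` with `|ν| < N` as an indicator sum over `Finset.range N`:
the extra indices `|ν| < i < N` index empty rows. [folklore] -/
private theorem chargeBelow_eq_sum_range_ite {ν : Finset (ℕ × ℕ)} (hν : IsLowerSet (ν : Set (ℕ × ℕ)))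
    {N : ℕ} (hN : ν.card < N) (r : ℕ) :
    chargeBelow ν r = ∑ i ∈ Finset.range N, (if r < i then rowCharge ν i else 0) := by
  rw [chargeBelow, ← Finset.sum_filter]
  refine Finset.sum_subset (fun i hi => ?_) (fun i hi hi' => ?_)
  · simp only [Finset.mem_filter, Finset.mem_range] at hi ⊢
    exact ⟨by omega, hi.2⟩
  · simp only [Finset.mem_filter, Finset.mem_range, not_and'] at hi hi'
    have := hi' hi.2
    exact rowCharge_eq_zero_of_card_le' hν (by omega)

set_option linter.dupNamespace false in
/-- The column tail `C(c)` of a lower set `ν` with `|ν| < N` as an indicator sum over `Finset.range N`: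
the extra indices `|ν| < j < N` index empty columns. [folklore] -/
private theorem chargeRight_eq_sum_range_ite {ν : Finset (ℕ × ℕ)} (hν : IsLowerSet (ν : Set (ℕ × ℕ)))
    {N : ℕ} (hN : ν.card < N) (c : ℕ) :
    chargeRight ν c = ∑ j ∈ Finset.range N, (if c < j then colCharge ν j else 0) := by
  rw [chargeRight, ← Finset.sum_filter]
  refine Finset.sum_subset (fun j hj => ?_) (fun j hj hj' => ?_)
  · simp only [Finset.mem_filter, Finset.mem_range] at hj ⊢
    exact ⟨by omega, hj.2⟩
  · simp only [Finset.mem_filter, Finset.mem_range, not_and'] at hj hj'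
    have := hj' hj.2
    exact colCharge_eq_zero_of_card_le' hν (by omega)

set_option linter.dupNamespace false in
/-- Row lengths of a prefix shape: by injectivity of the filling, row `i` of `shapeBefore T.1 k` has as many
cells as there are entries `j < k` in row `i`. [folklore] -/
private theorem rowLen_shapeBefore {n : ℕ} {Y : YoungDiagram} (T : StdFilling n Y) (k : Fin n) (i : ℕ) :
    rowLen (shapeBefore T.1 k) i = (Finset.univ.filter (fun j : Fin n => j < k ∧ (T.1 j).1 = i)).card := by
  rw [rowLen, shapeBefore, Finset.filter_image, Finset.card_image_of_injective _ T.injective,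
    Finset.filter_filter]
  rfl

set_option linter.dupNamespace false in
/-- Column lengths of a prefix shape: by injectivity of the filling, column `i` of `shapeBefore T.1 k` has as
many cells as there are entries `j < k` in column `i`. [folklore] -/
private theorem colLen_shapeBefore {n : ℕ} {Y : YoungDiagram} (T : StdFilling n Y) (k : Fin n) (i : ℕ) :
    colLen (shapeBefore T.1 k) i = (Finset.univ.filter (fun j : Fin n => j < k ∧ (T.1 j).2 = i)).card := by
  rw [colLen, shapeBefore, Finset.filter_image, Finset.card_image_of_injective _ T.injective,
    Finset.filter_filter]
  rfl

set_option linter.dupNamespace false in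
/-- **Stub `pairDiff_eq_sum_incr` (line `klr-graded-polynomial-method`, crux
`SnSubsetDichotomy.NoThresholdSubsetTriple`, stmt-MatrixMultiplication-8302): the increment identity in
`PlancherelStep` language.**  The parity-signed SW-minus-NE pair count `J(T)` of a standard Young tableau `T` of
shape `μ ⊢ n` equals `Σ_k π_k · incr (shapeBefore T.1 k) (T.1 k)`: the J-increment of the `k`-th growth step
`shapeBefore T.1 k ↦ insert (T.1 k) (shapeBefore T.1 k)`, signed by `π_k = (−1)^(row k + col k)` and summed over
the growth.  From `stub_pairDiff_eq_chargeSum` by the dictionary `rowLen (shapeBefore T.1 k) i = #{j < k in row i}`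
(injectivity) and the vanishing of the charges of the (empty) rows/columns of index `≥ k` of the `k`-cell lower
set `shapeBefore T.1 k` (`shapeBefore_api`). [folklore] -/
theorem pairDiff_eq_sum_incr : ∀ (n : ℕ) (μ : Nat.Partition n) (T : Literature.NumberTheory.DiophantineGeometry.StdFilling n μ.youngDiagram), ((∑ k : Fin n, ∑ j ∈ Finset.univ.filter (fun j : Fin n => j < k ∧ (T.1 k).1 < (T.1 j).1 ∧ (T.1 j).2 < (T.1 k).2), (-1 : ℤ) ^ ((T.1 j).1 + (T.1 j).2 + (T.1 k).1 + (T.1 k).2)) - (∑ k : Fin n, ∑ j ∈ Finset.univ.filter (fun j : Fin n => j < k ∧ (T.1 j).1 < (T.1 k).1 ∧ (T.1 k).2 < (T.1 j).2), (-1 : ℤ) ^ ((T.1 j).1 + (T.1 j).2 + (T.1 k).1 + (T.1 k).2))) = ∑ k : Fin n, (-1 : ℤ) ^ ((T.1 k).1 + (T.1 k).2) * PlancherelStep.incr (PlancherelStep.shapeBefore T.1 k) (T.1 k) := by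
  intro n μ T
  rw [stub_pairDiff_eq_chargeSum n μ T]
  refine Finset.sum_congr rfl fun k _ => ?_
  congr 1
  obtain ⟨-, -, hcard, hlower, -⟩ := shapeBefore_api n μ.youngDiagram T μ.card_cells_youngDiagram
  have hk : (shapeBefore T.1 k).card < n := by
    rw [hcard k k.2.le]
    exact k.2
  rw [incr, chargeBelow_eq_sum_range_ite (hlower k) hk, chargeRight_eq_sum_range_ite (hlower k) hk]
  congr 1 <;> refine Finset.sum_congr rfl fun i _ => ?_
  · rw [ite_and, rowCharge, rowLen_shapeBefore]
  · rw [ite_and, colCharge, colLen_shapeBefore]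

end Summit.MatrixMultiplication.MatrixMultiplication.Theorems
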